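import Summits.BirchSwinnertonDyer.Uniform.U3.IwasawaDescentAtThree
import Summits.BirchSwinnertonDyer.Uniform.U3.IwasawaDescentAtThreeKatoFree
import HarnessLib

/-!
# U3 / ROUTE-IW, capstone: the conditional uniform LOWER half at `3` in the IMAGE-FREE shape of
# `N10.LowerHalf` — H★ + H7 (+ printed inputs) ⟹ `MissingLowerBoundAt W 3` on every rank-`0`
# potentially-ordinary additive row at `3`, no Kato, no surjectivity (cell `bsd-uniform`, seat u3-p1)

HONEST FRAMING (cell `bsd-uniform`, run/shared/lean/pub/bsd-uniform/, verbatim in every file): the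
goal of the cell is a CONDUCTOR-FREE BSD formula in analytic rank `≤ 1` via UNIFORM CLASS THEOREMS
whose hypotheses are class predicates and PRINTED theorems, replacing per-curve certificates. THIS
FILE proves NO unconditional uniform theorem: it composes the two landed U3 files
`IwasawaDescentAtThreeKatoFree` (H★ + H7 ⟹ A0, Kato-free, image-free; ROUTE-IW §8 P3) and
`IwasawaDescentAtThree` (A0 ⟹ `MissingLowerBoundAt W 3`; P1) into ONE statement of the shape of the
prior cell's class conjecture `N10.LowerHalf` at `p = 3` — `∀ W`, analytic rank `0`, additive at `3`,
potentially multiplicative or (G)-ordinary, off the CM / anomalous rows of the (G)-part — whose ONLY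
non-printed inputs are the route's boxed H★ (`ChiBranchRatLowerDvdOddAt W 3` / `…MultOddAt W 3`,
`@[conjecture]`, the `ω`-branch Eisenstein containment; NOT in print) and the `μ`-certificate H7
(per pair a finite `3`-adic computation; uniformly Greenberg's `μ = 0`). ROUTE-IW §7 priced this
image-free form at 0.75 ("one new Λ-algebra lemma"); the lemma landed (p339687), so the statement is
now a kernel theorem. CONDITIONAL; nothing booked (referee rule R-U3); no density moves; residue
rows HOME/RESIDUE.md §U3 R3-IW-1…5. No summit claim.

WHY THIS IS NOVEL (one sentence): the first image-free (X3, X4-surjective AND X4-non-surjective =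
census pocket O8 alike) conditional LOWER-half statement at an additive `3` in the tree whose
conjectural input is the ONE-SIDED rational branch containment rather than a main-conjecture equality
or a Kato/Kolyvagin-system input. Theorems only (no `def`, no `sorry`).
-/

noncomputable section

open scoped Classical NumberField MatrixGroups ModularForm

open CongruenceSubgroup WeierstrassCurve NumberField IsDedekindDomain
  Literature.NumberTheory.EllipticCurves
  Literature.NumberTheory.EllipticCurves.ModularForms
  Literature.NumberTheory.EllipticCurves.Rank1Residual
  Literature.NumberTheory.EllipticCurves.Rank1Residual.Typed
  Summit.BirchSwinnertonDyer.Rank1Residual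
  Summit.BirchSwinnertonDyer.Rank1Residual.Additive

namespace Summit.BirchSwinnertonDyer.Uniform.U3

variable {W : WeierstrassCurve ℚ} [W.IsElliptic] [W.IsGloballyMinimal]

/-- **Per pair, image-free, Kato-free**: on a rank-`0` potentially-ordinary additive row at `3` (off
the CM / anomalous rows of its (G)-part), H★ + H7 give `ord₃ #Ш(E)_an ≤ ord₃ #Ш(E)` — printed inputs
Delbourgo 1998 Prop. 4 exact on (M) (`hDelX`), Delbourgo 2002 (A)+(B) at `3` (`hDel3`), GZK,
modularity, a modular parametrisation datum (`hmodD`). No hypothesis on the mod-`3` image.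
[cite: Delbourgo1998, Prop. 4 (p. 144), §2.2 Lemma (ii) (p. 139), Main Conjecture (p. 151; held p0029 L59–75)]
[cite: Delbourgo2002, Theorem (A), (B) (p. 40)] [cite: Washington1997, §7.1] [cite: Miller2011LMS, Def. 1.1] -/
theorem missingLowerBoundAt_three_rankZero_of_omegaBranchEisenstein_of_unitCoeff [Fact (Nat.Prime 3)]
    (hDelX : Delbourgo1998.prop4_rankZero_constantCoeff_eq_unit_mul_of_potMult)
    (hDel3 : Delbourgo2002.mainTheorem_three)
    (hGZK : rank_eq_analyticRank_of_analyticRank_le_one) (hmod : hasEntireLFunction_rat)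
    (hmodD : nonempty_modularParametrizationData)
    (hadd : Addv W 3) (hord : Additive.PotMult W 3 ∨ TypeGOrd W 3) (hr : W.analyticRank = 0)
    (hcm : TypeGOrd W 3 → ¬ W.HasCM) (hna : TypeGOrd W 3 → Delbourgo2002.ReductionNonAnomalous W 3)
    (hEisG : ChiBranchRatLowerDvdOddAt W 3) (hEisM : ChiBranchRatLowerDvdMultOddAt W 3)
    (hcertG : ∀ (V : WeierstrassCurve ℚ) [V.IsElliptic] [V.IsGloballyMinimal] (C : VariableChange ℚ),
      GoodOrd V 3 → C • V.quadraticTwist (-(3 : ℚ)) = W →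
      ∀ {N : ℕ} [NeZero N] (f : CuspForm (Gamma0 N) 2), IsNewformOf V f →
      ∀ ϖ : ℚ, (ϖ : ℝ) * V.imaginaryPeriodRat = minusPeriod f →
      ∃ n : ℕ, ‖PowerSeries.coeff n
        (PowerSeries.C (ϖ : ℚ_[3]) * padicLFunctionMinusBranch f (unitRoot V 3 : ℚ_[3]) (3 / 2))‖ = 1)
    (hcertM : MultOddBranchUnitCoeffCert W 3) : MissingLowerBoundAt W 3 :=
  missingLowerBoundAt_three_rankZero_of_cycLowerLeadingTerm hDelX hDel3 hGZK hmod hadd hord hr hcm hna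
    (cycLowerLeadingTerm_three_of_omegaBranchEisenstein_of_unitCoeff hmod hmodD hadd hord hEisG hEisM
      hcertG hcertM)

/-- **Class level, the shape of `N10.LowerHalf` at `3` (image-free), CONDITIONAL on H★ and H7**: if
the `ω`-branch Eisenstein containments and the `μ`-certificates hold on every potentially-ordinary
additive row at `3`, then `ord₃ #Ш_an ≤ ord₃ #Ш` holds on every such row of analytic rank `0` off the
CM / anomalous rows of the (G)-part — everything else being printed (Delbourgo 1998/2002, GZK,
modularity). ROUTE-IW §7's image-free conditional uniform theorem.
[cite: Delbourgo1998, Prop. 4 (p. 144), Main Conjecture (p. 151; held p0029 L59–75)]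
[cite: Delbourgo2002, Theorem (A), (B) (p. 40)] [cite: Washington1997, §7.1] [cite: Miller2011LMS, Def. 1.1] -/
theorem forall_missingLowerBoundAt_three_of_forall_omegaBranchEisenstein_of_unitCoeff
    [Fact (Nat.Prime 3)]
    (hDelX : Delbourgo1998.prop4_rankZero_constantCoeff_eq_unit_mul_of_potMult)
    (hDel3 : Delbourgo2002.mainTheorem_three)
    (hGZK : rank_eq_analyticRank_of_analyticRank_le_one) (hmod : hasEntireLFunction_rat)
    (hmodD : nonempty_modularParametrizationData)
    (hEis : ∀ (W : WeierstrassCurve ℚ) [W.IsElliptic] [W.IsGloballyMinimal],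
      Addv W 3 → (Additive.PotMult W 3 ∨ TypeGOrd W 3) →
        ChiBranchRatLowerDvdOddAt W 3 ∧ ChiBranchRatLowerDvdMultOddAt W 3)
    (hcert : ∀ (W : WeierstrassCurve ℚ) [W.IsElliptic] [W.IsGloballyMinimal],
      Addv W 3 → (Additive.PotMult W 3 ∨ TypeGOrd W 3) →
        (∀ (V : WeierstrassCurve ℚ) [V.IsElliptic] [V.IsGloballyMinimal] (C : VariableChange ℚ),
          GoodOrd V 3 → C • V.quadraticTwist (-(3 : ℚ)) = W →
          ∀ {N : ℕ} [NeZero N] (f : CuspForm (Gamma0 N) 2), IsNewformOf V f →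
          ∀ ϖ : ℚ, (ϖ : ℝ) * V.imaginaryPeriodRat = minusPeriod f →
          ∃ n : ℕ, ‖PowerSeries.coeff n
            (PowerSeries.C (ϖ : ℚ_[3]) * padicLFunctionMinusBranch f (unitRoot V 3 : ℚ_[3]) (3 / 2))‖ = 1) ∧
        MultOddBranchUnitCoeffCert W 3) :
    ∀ (W : WeierstrassCurve ℚ) [W.IsElliptic] [W.IsGloballyMinimal],
      W.analyticRank = 0 → Addv W 3 → (Additive.PotMult W 3 ∨ TypeGOrd W 3) →
        (TypeGOrd W 3 → ¬ W.HasCM) → (TypeGOrd W 3 → Delbourgo2002.ReductionNonAnomalous W 3) →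
        MissingLowerBoundAt W 3 :=
  fun W _ _ hr hadd hord hcm hna ↦
    missingLowerBoundAt_three_rankZero_of_omegaBranchEisenstein_of_unitCoeff hDelX hDel3 hGZK hmod hmodD
      hadd hord hr hcm hna (hEis W hadd hord).1 (hEis W hadd hord).2 (hcert W hadd hord).1
      (hcert W hadd hord).2

end Summit.BirchSwinnertonDyer.Uniform.U3

end
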